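import Summits.PneNP.PneNP.Theses.CanonicalForms

/-!
# Route CanonicalForms — `Assembly` (stmt-PneNP-10669)

`Assembly := PEqNotCF → CanonOfPEqNP → CookBridge → PneNP`: the cruxes-to-summit composition of route CanonicalForms, which is exactly
the route's deciding theorem `Summit.PneNP.PneNP.Theses.CanonicalForms.closes` (planner-authored, elaborated with the route file)
applied to the same hypotheses. This file imports only the route file (cone hygiene).
-/

set_option linter.dupNamespace false -- `Summit.PneNP.PneNP.…`: summit = sub-problem name (D-0017 single-conjunct layout)

namespace Summit.PneNP.PneNP.Theorems

/-- **Assembly item of route CanonicalForms (stmt-PneNP-10669)**: `PEqNotCF → CanonOfPEqNP → CookBridge → PneNP`, by the route's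
deciding theorem `CanonicalForms.closes` (if `Classes.P = NP`, `CanonOfPEqNP` canonizes the witness relation of `PEqNotCF`,
contradiction; `CookBridge` concludes). [folklore] -/
theorem canonicalForms_assembly_proof : Summit.PneNP.PneNP.Theses.CanonicalForms.Assembly := by
  unfold Summit.PneNP.PneNP.Theses.CanonicalForms.Assembly
  exact fun hX hC hB => Summit.PneNP.PneNP.Theses.CanonicalForms.closes hX hC hB

end Summit.PneNP.PneNP.Theorems
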